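import Summits.QuantumFields.YangMills.Theorems.LuscherReductionOneSiteLevelsOfAL1
import Literature.Analysis.OperatorTheory.YangMillsMatrixModelAL1Holds

/-!
# Crux ONE `OneSiteLevels` (route `LuscherReduction`, item stmt-QuantumFields-20007) — CLOSED UNCONDITIONALLY

The conditional closure `oneSiteLevels_of_AL1 : (∀ k, LuscherHamiltonianEigenfunctions k) → OneSiteLevels` (p493257, fleet lead
ym-luscher-20007-p1 g2: composition of the line `birth` — INNER `innerOfFlatKac ∘ flatKac_of_AL1`, VALLEY `oneSiteAbsUpperValleyMag`,
OUTER seam, LOWER `oneSiteAbsLower_of_eigenfunctions`) applied to the now-PROVED Literature theorem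
`Literature.Analysis.OperatorTheory.YMMatrixModel.LuscherHamiltonianEigenfunctions_holds` (AL1 discharged: variational eigenbasis on the
invariant core + SO(3)-averaging + hypoellipticity + Agmon decay; seats ym-luscher-20007-p2, ym-beyond-lit, ym-luscher-20007-p1).

`oneSiteLevels_proof : Summit.QuantumFields.YangMills.Theses.LuscherReduction.OneSiteLevels` — unconditional; and the one-site rung leaf
`femtoGapOneSite_proof : FemtoGapOneSite`.

HONEST FRAMING: the semiclassical spectral asymptotics of the ONE-SITE (`L = 1`) three-matrix `SU(2)` model — the femto rung R2b1's crux ONE;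
nothing here is infinite volume, a mass gap or the Clay problem.  Sorry-free; no new definitions, no named-fact hypotheses.
-/

noncomputable section

namespace Summit.QuantumFields.YangMills.Theorems.FemtoTransferGap

open Literature.Analysis.OperatorTheory.YMMatrixModel

/-- ★★★ **Crux ONE, unconditionally**: the one-site `SU(2)` transfer operator has `μ₀ > 0` and
`e^{−(Δ_kλ_b + Cλ_b²)}μ₀ ≤ μ_k ≤ e^{−(Δ_kλ_b − Cλ_b²)}μ₀` for `B ≥ B₀(k)` — the route decl `Theses.LuscherReduction.OneSiteLevels`.
[cite: Luscher1983, §2] [cite: ReedSimonIV1978, Thm. XIII.64] -/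
theorem oneSiteLevels_proof : Summit.QuantumFields.YangMills.Theses.LuscherReduction.OneSiteLevels :=
  oneSiteLevels_of_AL1 fun k => LuscherHamiltonianEigenfunctions_holds k

/-- The one-site rung leaf `FemtoGapOneSite`, unconditionally. [cite: Luscher1983, §2] -/
theorem femtoGapOneSite_proof : FemtoGapOneSite :=
  femtoGapOneSite_of_AL1 fun k => LuscherHamiltonianEigenfunctions_holds k

end Summit.QuantumFields.YangMills.Theorems.FemtoTransferGap

end
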